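import Summits.ResolutionOfSingularities.ResolutionOfSingularities.Theorems.PurelyInseparableDim4ResConeLightTrichotomy
import HarnessLib
import HarnessLib.Audit.Tags

/-!
# Purely inseparable four-folds — the LIGHT-PAIR DICHOTOMY: with two alive boundary letters, a free tail or both
# letters stretch-born (K2(p) lane, slice B, entry bookkeeping of the C∞ regime; cell `res-dim4-pi`)

[OURS · counted 0 · cell `res-dim4-pi` · K2(p) lane (holder res-dim4-p-12 g3); the `|B_k| = 2` instance of
res-dim4-idea-4 g3's eventually-permanent-letters pigeonhole (bus 2026-08-29 01:15Z / 01:31Z), typed after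
res-dim4-p-9 g3's three-letter core `light_tail_trichotomy_core` (K26b); seat res-dim4-p-2 g4 (offer K28 (b)).]
Pure `(r, j, b)` bookkeeping; nothing here proves K2(p)/K2(5), `NoIsolatedTrap p p` or resolution of singularities
in dimension ≥ 4 / characteristic `p`.  AI kernel work, weaker than expert review.

For an alive-set walk `B : ℕ → Finset (Fin 4)` with the boundary law
`i ∈ B (k+1) ↔ i = j k ∨ (i ∈ B k ∧ b k i = 0)` (K26b `mem_support_r_succ_iff` on every isolated above-floor
chain) and exactly TWO alive letters from `k₀` on (the light `d = 4` = C∞ regime at `p = 5`: `o ≡ 6`, weights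
`(1, 1)`), every step hits exactly one alive letter (`exists_hit_of_law_two`), so at most one letter is eventually
permanent, and (**`light_pair_dichotomy_core`**) either (T1) the chain has a FREE tail
(`j (k+1) = j k ∨ b (k+1) (j k) ≠ 0` eventually) or (T2′) from some `k₁ ≥ k₀` on every alive letter is BORN in the
stretch and kept since (`∃ t, k₀ ≤ t < k, j t = i, ∀ m ∈ (t, k), j m ≠ i ∧ b m i = 0`) — the entry configuration
of the pair-merged ledger.  Dress: **`light_pair_dichotomy`** on `B k = (c k).r.support`.
bears_on: LADDER-RESOLUTION:D157-DOOR2 (res-dim4-pi · K2(p) · slice B · C∞ entry).  Supports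
stmt-ResolutionOfSingularities-16155 (helper).
-/

set_option linter.dupNamespace false -- mandated namespace of this single-conjunct summit

noncomputable section

namespace Summit.ResolutionOfSingularities.ResolutionOfSingularities.Theorems.PIDim4

namespace ResCone

open MvPolynomial Finset
open Literature.AlgebraicGeometry.Resolution
open Literature.AlgebraicGeometry.Resolution.CentreBlowup
open Literature.AlgebraicGeometry.Resolution.Hauser2010
open Literature.AlgebraicGeometry.Resolution.HauserPerlega2019

/-! ## 1. The core: an alive-set walk with two letters -/

section Core

variable {β : Type} [Zero β]

/-- **Every step hits an alive letter** (two-letter form): under the boundary law with `|B k| = |B (k+1)| = 2`,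
either the chart letter is alive or some alive letter is translated. [folklore] -/
theorem exists_hit_of_law_two {B : ℕ → Finset (Fin 4)} {j : ℕ → Fin 4} {b : ℕ → Fin 4 → β} {k₀ k : ℕ}
    (hlaw : ∀ k, k₀ ≤ k → ∀ i, i ∈ B (k + 1) ↔ i = j k ∨ (i ∈ B k ∧ b k i = 0))
    (hcard : ∀ k, k₀ ≤ k → (B k).card = 2) (hk : k₀ ≤ k) :
    ∃ x ∈ B k, j k = x ∨ b k x ≠ 0 := by
  classical
  by_cases hj : j k ∈ B k
  · exact ⟨j k, hj, Or.inl rfl⟩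
  · by_contra hno
    push Not at hno
    have hsub : insert (j k) (B k) ⊆ B (k + 1) := by
      intro i hi
      rw [Finset.mem_insert] at hi
      rw [hlaw k hk]
      rcases hi with rfl | hi
      · exact Or.inl rfl
      · exact Or.inr ⟨hi, (hno i hi).2⟩
    have h3 := Finset.card_le_card hsub
    rw [Finset.card_insert_of_notMem hj, hcard k hk, hcard (k + 1) (by omega)] at h3
    omega

/-- **THE LIGHT-PAIR DICHOTOMY, core form.**  For an alive-set walk with the boundary law and two alive letters
from `k₀` on: (T1) a free tail, or (T2′) from some `k₁ ≥ k₀` on every alive letter is born in the stretch.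
Proof: the eventually-permanent letters are `≤ 1` (each step hits an alive non-permanent letter); one permanent
letter forces every step to hit the newest letter (free tail); none means every alive letter is born from the
last time it was hit (res-dim4-idea-4 g3's pigeonhole, two-letter instance). [OURS] [folklore] -/
theorem light_pair_dichotomy_core {B : ℕ → Finset (Fin 4)} {j : ℕ → Fin 4} {b : ℕ → Fin 4 → β} {k₀ : ℕ}
    (hlaw : ∀ k, k₀ ≤ k → ∀ i, i ∈ B (k + 1) ↔ i = j k ∨ (i ∈ B k ∧ b k i = 0))
    (hcard : ∀ k, k₀ ≤ k → (B k).card = 2) :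
    (∃ k₁, k₀ ≤ k₁ ∧ ∀ k, k₁ ≤ k → (j (k + 1) = j k ∨ b (k + 1) (j k) ≠ 0)) ∨
    (∃ k₁, k₀ ≤ k₁ ∧ ∀ k, k₁ ≤ k → ∀ i, i ∈ B k →
        ∃ t, k₀ ≤ t ∧ t < k ∧ j t = i ∧ ∀ m, t < m → m < k → j m ≠ i ∧ b m i = 0) := by
  classical
  let Kept : ℕ → Fin 4 → Prop := fun k i => i ∈ B k ∧ j k ≠ i ∧ b k i = 0
  let Perm : Fin 4 → Prop := fun i => ∃ m, k₀ ≤ m ∧ ∀ k, m ≤ k → Kept k i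
  set P : Finset (Fin 4) := Finset.univ.filter Perm with hP
  -- (a) a common threshold `M ≥ k₀` for the permanent letters
  obtain ⟨M, hMk₀, hM⟩ : ∃ M, k₀ ≤ M ∧ ∀ i ∈ P, ∀ k, M ≤ k → Kept k i := by
    have key : ∀ Q : Finset (Fin 4), Q ⊆ P → ∃ M, k₀ ≤ M ∧ ∀ i ∈ Q, ∀ k, M ≤ k → Kept k i := by
      intro Q
      induction Q using Finset.induction_on with
      | empty => intro _; exact ⟨k₀, le_rfl, fun i hi => absurd hi (Finset.notMem_empty i)⟩
      | insert a Q ha ih =>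
        intro hsub
        obtain ⟨M, hM0, hM⟩ := ih (fun i hi => hsub (Finset.mem_insert_of_mem hi))
        have haP : Perm a := (Finset.mem_filter.mp (hsub (Finset.mem_insert_self a Q))).2
        obtain ⟨m, hm0, hm⟩ := haP
        refine ⟨max M m, le_max_of_le_left hM0, fun i hi k hk => ?_⟩
        rw [Finset.mem_insert] at hi
        rcases hi with rfl | hi
        · exact hm k (le_trans (le_max_right M m) hk)
        · exact hM i hi k (le_trans (le_max_left M m) hk)
    exact key P le_rfl
  -- (b) `P ⊆ B k` for `k ≥ M`, the hit letter is alive and not permanent, so `|P| ≤ 1`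
  have hPsub : ∀ k, M ≤ k → P ⊆ B k := fun k hk i hi => (hM i hi k hk).1
  have hhit : ∀ k, M ≤ k → ∃ x ∈ B k, x ∉ P ∧ (j k = x ∨ b k x ≠ 0) := by
    intro k hk
    obtain ⟨x, hx, hor⟩ := exists_hit_of_law_two hlaw hcard (le_trans hMk₀ hk)
    refine ⟨x, hx, fun hxP => ?_, hor⟩
    have hkept := hM x hxP k hk
    rcases hor with h | h
    · exact hkept.2.1 h
    · exact h hkept.2.2
  have hPcard : P.card ≤ 1 := by
    obtain ⟨x, hx, hxP, -⟩ := hhit M le_rfl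
    have hsub : P ⊆ (B M).erase x := fun i hi =>
      Finset.mem_erase.mpr ⟨fun h => hxP (h ▸ hi), hPsub M le_rfl hi⟩
    have h := Finset.card_le_card hsub
    rw [Finset.card_erase_of_mem hx, hcard M hMk₀] at h
    omega
  -- (c) non-permanent letters: a time `≥ k₀` at which they are not kept, below a common bound `k₁`
  have hnp : ∀ i, i ∉ P → ∀ m, k₀ ≤ m → ∃ t, m ≤ t ∧ ¬ Kept t i := by
    intro i hi m hm
    by_contra hall
    push Not at hall
    exact hi (Finset.mem_filter.mpr ⟨Finset.mem_univ i, m, hm, fun k hk => hall k hk⟩)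
  obtain ⟨k₁, hk₁M, hk₁⟩ : ∃ k₁, M ≤ k₁ ∧ ∀ i, i ∉ P → ∃ t, k₀ ≤ t ∧ t < k₁ ∧ ¬ Kept t i := by
    have key : ∀ Q : Finset (Fin 4), ∃ k₁, M ≤ k₁ ∧ ∀ i ∈ Q, i ∉ P → ∃ t, k₀ ≤ t ∧ t < k₁ ∧ ¬ Kept t i := by
      intro Q
      induction Q using Finset.induction_on with
      | empty => exact ⟨M, le_rfl, fun i hi => absurd hi (Finset.notMem_empty i)⟩
      | insert a Q ha ih =>
        obtain ⟨k₁, hk₁M, hk₁⟩ := ih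
        by_cases haP : a ∈ P
        · refine ⟨k₁, hk₁M, fun i hi hiP => ?_⟩
          rw [Finset.mem_insert] at hi
          rcases hi with rfl | hi
          · exact absurd haP hiP
          · exact hk₁ i hi hiP
        · obtain ⟨t, ht0, ht⟩ := hnp a haP k₀ le_rfl
          refine ⟨max k₁ (t + 1), le_trans hk₁M (le_max_left _ _), fun i hi hiP => ?_⟩
          rw [Finset.mem_insert] at hi
          rcases hi with rfl | hi
          · exact ⟨t, ht0, by omega, ht⟩
          · obtain ⟨t', ht'0, ht'lt, ht'⟩ := hk₁ i hi hiP
            exact ⟨t', ht'0, by omega, ht'⟩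
    obtain ⟨k₁, hk₁M, hk₁⟩ := key Finset.univ
    exact ⟨k₁, hk₁M, fun i hiP => hk₁ i (Finset.mem_univ i) hiP⟩
  have hk₁k₀ : k₀ ≤ k₁ := le_trans hMk₀ hk₁M
  -- (d) BORN: an alive non-permanent letter at `k ≥ k₁` was created at the last time it was not kept
  have hborn : ∀ k, k₁ ≤ k → ∀ i, i ∉ P → i ∈ B k →
      ∃ t, k₀ ≤ t ∧ t < k ∧ j t = i ∧ ∀ m, t < m → m < k → j m ≠ i ∧ b m i = 0 := by
    intro k hk i hiP hiB
    set S : Finset ℕ := (Finset.range k).filter (fun t => k₀ ≤ t ∧ ¬ Kept t i) with hS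
    have hSne : S.Nonempty := by
      obtain ⟨t, ht0, htlt, ht⟩ := hk₁ i hiP
      exact ⟨t, Finset.mem_filter.mpr ⟨Finset.mem_range.mpr (by omega), ht0, ht⟩⟩
    set t := S.max' hSne with ht
    have htS : t ∈ S := Finset.max'_mem S hSne
    have hmem := Finset.mem_filter.mp htS
    have htlt : t < k := Finset.mem_range.mp hmem.1
    have ht0 : k₀ ≤ t := hmem.2.1
    have htnk : ¬ Kept t i := hmem.2.2
    have hkept : ∀ m, t < m → m < k → Kept m i := by
      intro m htm hmk
      by_contra hm
      have hmS : m ∈ S := Finset.mem_filter.mpr ⟨Finset.mem_range.mpr hmk, by omega, hm⟩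
      have := Finset.le_max' S m hmS
      rw [← ht] at this
      omega
    have hiB1 : i ∈ B (t + 1) := by
      by_cases h : t + 1 < k
      · exact (hkept (t + 1) (by omega) h).1
      · have : t + 1 = k := by omega
        rw [this]; exact hiB
    have hjt : j t = i := by
      rcases (hlaw t ht0 i).mp hiB1 with h | ⟨hBt, hbt⟩
      · exact h.symm
      · by_contra hne
        exact htnk ⟨hBt, hne, hbt⟩
    exact ⟨t, ht0, htlt, hjt, fun m htm hmk => ⟨(hkept m htm hmk).2.1, (hkept m htm hmk).2.2⟩⟩
  -- (e) the two cases `|P| = 1, 0`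
  rcases Nat.lt_or_ge P.card 1 with h0 | h1
  · -- |P| = 0: (T2′)
    right
    refine ⟨k₁, hk₁k₀, fun k hk i hi => hborn k hk i ?_ hi⟩
    intro hiP
    have : 0 < P.card := Finset.card_pos.mpr ⟨i, hiP⟩
    omega
  · -- |P| = 1: (T1)
    left
    have hP1 : P.card = 1 := le_antisymm hPcard h1
    refine ⟨k₁, hk₁k₀, fun k hk => ?_⟩
    have hk0 : k₀ ≤ k := le_trans hk₁k₀ hk
    have hjB : j k ∈ B (k + 1) := (hlaw k hk0 (j k)).mpr (Or.inl rfl)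
    have hjP : j k ∉ P := by
      intro hjP
      exact (hM (j k) hjP k (le_trans hk₁M hk)).2.1 rfl
    obtain ⟨x, hxB, hxP, hor⟩ := hhit (k + 1) (by omega)
    -- `B (k+1) ⊇ P ∪ {j k, x}` with `|B (k+1)| = 2`, `|P| = 1` ⇒ `x = j k`
    have hx : x = j k := by
      by_contra hne
      have hsub : insert x (insert (j k) P) ⊆ B (k + 1) := by
        intro i hi
        rw [Finset.mem_insert, Finset.mem_insert] at hi
        rcases hi with rfl | rfl | hi
        · exact hxB
        · exact hjB
        · exact hPsub (k + 1) (by omega) hi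
      have h := Finset.card_le_card hsub
      rw [Finset.card_insert_of_notMem (by rw [Finset.mem_insert]; push Not; exact ⟨hne, hxP⟩),
        Finset.card_insert_of_notMem hjP, hP1, hcard (k + 1) (by omega)] at h
      omega
    rw [hx] at hor
    exact hor

end Core

/-! ## 2. The dress: witnessed isolated above-floor chains with two boundary letters -/

section Chain

variable {K : Type} [Field K] [DecidableEq K]

/-- **THE LIGHT-PAIR DICHOTOMY** (C∞ entry bookkeeping): along a witnessed isolated above-floor `Step0 p` chain with
exactly two boundary letters from `k₀` on, either (T1) the chain has a free tail (`¬ IsSatellite` eventually), or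
(T2′) from some `k₁ ≥ k₀` on every boundary letter is stretch-born and kept since its birth. [OURS] [folklore] -/
theorem light_pair_dichotomy (p : ℕ) [Fact p.Prime] {c : ℕ → State K} {j : ℕ → Fin 4} {b : ℕ → Fin 4 → K}
    (hc : ∀ k, IsIsolated p (c k).F ∧ Step0 p (c k) (c (k + 1))) (hw : FreeTail.IsWitnessedChain p c j b)
    (hfloor : ∀ k, ordZero (c k).F ≠ p) {k₀ : ℕ} (hB2 : ∀ k, k₀ ≤ k → (c k).r.support.card = 2) :
    (∃ k₁, k₀ ≤ k₁ ∧ ∀ k, k₁ ≤ k → ¬ FreeTail.IsSatellite j b k) ∨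
    (∃ k₁, k₀ ≤ k₁ ∧ ∀ k, k₁ ≤ k → ∀ i, 1 ≤ (c k).r i →
        ∃ t, k₀ ≤ t ∧ t < k ∧ j t = i ∧ ∀ m, t < m → m < k → j m ≠ i ∧ b m i = 0) := by
  have hlaw : ∀ k, k₀ ≤ k → ∀ i, i ∈ (c (k + 1)).r.support ↔ i = j k ∨ (i ∈ (c k).r.support ∧ b k i = 0) :=
    fun k _ i => mem_support_r_succ_iff p hc hw hfloor k i
  have halive : ∀ k i, 1 ≤ (c k).r i ↔ i ∈ (c k).r.support := fun k i => by
    rw [Finsupp.mem_support_iff]; omega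
  rcases light_pair_dichotomy_core (B := fun k => (c k).r.support) hlaw hB2 with ⟨k₁, hk₁, h⟩ | ⟨k₁, hk₁, h⟩
  · left
    refine ⟨k₁, hk₁, fun k hk hsat => ?_⟩
    rcases h k hk with h | h
    · exact hsat.1 h
    · exact h hsat.2
  · right
    exact ⟨k₁, hk₁, fun k hk i hri => h k hk i ((halive k i).mp hri)⟩

end Chain

end ResCone

end Summit.ResolutionOfSingularities.ResolutionOfSingularities.Theorems.PIDim4

end
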